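import Summits.AnomalousDissipation.AnomalousDissipation.Theorems.GenericRunawayStokesScaling.Negative.Cone

/-!
# Crux `MirrorVariety.GenericRunawayStokesScaling` (stmt-AnomalousDissipation-2990), line `idea-sketch-ideator3`:
# the FRUSTRATED PROFILE step `stub_frustratedProfile`

On the Galerkin space `G = galerkinSubspace S` (`S = PB N`) the truncated Euler map is
`F₀(c) := galerkinRHS S 0 g c = ĝ - Q_S(c,c)` for `g ∈ G`, and `galerkinRHS S 0 0 c = -Q_S(c,c)` with `Q_S`
real 2-homogeneous.  If `F₀` is NOT proper at `g` (no margin `δ > 0` beyond any radius), pick `c_n ∈ G` with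
`‖c_n‖ ≥ n + 1`, `‖F₀(c_n)‖ < 1/(n+1)`; the unit vectors `u_n = c_n/‖c_n‖` have a convergent subsequence
`u_{φ n} → U` on the compact unit sphere of the finite-dimensional coefficient space, `U ∈ G` (closed),
`‖U‖ = 1`.  Then: (i) `-Q_S(u_n,u_n) = ‖c_n‖⁻² (F₀(c_n) - ĝ) → 0`, so `Q_S(U,U) = 0` by continuity
(`galerkinRHS S 0 0 U = 0`); (ii) the ENERGY identity `∑ Re⟪Q_S(c,c)_k, c_k⟫ = 0` gives
`∑ Re⟪ĝ_k, (u_n)_k⟫ = ∑ Re⟪F₀(c_n)_k, (u_n)_k⟫ → 0`, so `U` is work-free; (iii) the HELICITY identity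
`∑ Re⟪Q_S(c,c)_k, 2πi k × c_k⟫ = 0` gives `∑ Re⟪ĝ_k, 2πi k × (u_n)_k⟫ = ∑ Re⟪F₀(c_n)_k, 2πi k × (u_n)_k⟫ → 0`,
so `U` is helicity-free; (iv) `c ∘ φ` is the asymptotic sequence.  Supports stmt-AnomalousDissipation-2990.
-/

set_option linter.dupNamespace false

noncomputable section

open scoped BigOperators InnerProductSpace ComplexConjugate Topology
open Filter Set Function

namespace Summit.AnomalousDissipation.AnomalousDissipation.Theorems.GenericRunawayStokesScaling.Line

open Literature.Analysis.FunctionSpaces Literature.Analysis.FunctionSpaces.Torus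
open Literature.Analysis.FluidPDE Literature.Analysis.FluidPDE.Torus
open Summit.AnomalousDissipation.AnomalousDissipation.Theses.MirrorVariety
open Summit.AnomalousDissipation.AnomalousDissipation.Theorems.GenericRunawayStokesScaling.Negative

/-- The truncated Euler map on the Galerkin space: `F₀(c) = galerkinRHS S 0 g c = ĝ - Q_S(c,c)` for `g ∈ G`
(the Leray multiplier is the identity on `ĝ`). [folklore] -/
theorem frustratedProfile_galerkinRHS_zero_eq {S : Finset (Fin 3 → ℤ)} {g : ↥S → EuclideanSpace ℂ (Fin 3)}
    (hg : g ∈ galerkinSubspace S) (c : ↥S → EuclideanSpace ℂ (Fin 3)) :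
    galerkinRHS S 0 g c = g - projB S c c := by
  have h : galerkinRHS S 0 g c = Fmap S g (c, 0) := rfl
  rw [h, Fmap_apply]
  simp only [zero_smul, neg_zero, zero_add]
  congr 1
  funext k
  exact leraySym_apply_of_mem hg k

/-- The force-free truncated Euler map is minus the projected quadratic symbol:
`galerkinRHS S 0 0 c = -Q_S(c,c)`. [folklore] -/
theorem frustratedProfile_galerkinRHS_zero_zero_eq {S : Finset (Fin 3 → ℤ)} (c : ↥S → EuclideanSpace ℂ (Fin 3)) :
    galerkinRHS S 0 0 c = -projB S c c := by
  have h : galerkinRHS S 0 0 c = Fmap S 0 (c, 0) := rfl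
  rw [h, Fmap_apply]
  simp only [zero_smul, neg_zero, zero_add, Pi.zero_apply, leraySym_zero]
  funext k
  simp

/-- Two-homogeneity of the force-free truncated Euler map under real scalars:
`galerkinRHS S 0 0 (a • c) = a² • galerkinRHS S 0 0 c`. [folklore] -/
theorem frustratedProfile_galerkinRHS_zero_zero_smul {S : Finset (Fin 3 → ℤ)} (a : ℝ)
    (c : ↥S → EuclideanSpace ℂ (Fin 3)) :
    galerkinRHS S 0 0 (a • c) = (a * a) • galerkinRHS S 0 0 c := by
  rw [frustratedProfile_galerkinRHS_zero_zero_eq, frustratedProfile_galerkinRHS_zero_zero_eq, projB_smul_left,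
    projB_smul_right, smul_smul, smul_neg]

/-- The force-free truncated Euler map `c ↦ galerkinRHS S 0 0 c` is continuous. [folklore] -/
theorem frustratedProfile_continuous_galerkinRHS_zero_zero (S : Finset (Fin 3 → ℤ)) :
    Continuous fun c : ↥S → EuclideanSpace ℂ (Fin 3) => galerkinRHS S 0 0 c := by
  have h1 := continuous_galerkinRHS (S := S) (0 : ℝ)
  have h2 : Continuous fun c : ↥S → EuclideanSpace ℂ (Fin 3) =>
      ((0 : ↥S → EuclideanSpace ℂ (Fin 3)), c) := continuous_const.prodMk continuous_id
  have h3 := h1.comp h2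
  rw [Function.comp_def] at h3
  exact h3

/-- The work pairing `∑_k Re⟪a_k, b_k⟫` is real-homogeneous in the second slot. [folklore] -/
theorem frustratedProfile_sum_re_inner_smul {S : Finset (Fin 3 → ℤ)} (a b : ↥S → EuclideanSpace ℂ (Fin 3)) (r : ℝ) :
    ∑ k : ↥S, (inner ℂ (a k) ((r • b) k)).re = r * ∑ k : ↥S, (inner ℂ (a k) (b k)).re := by
  rw [Finset.mul_sum]
  refine Finset.sum_congr rfl fun k _ => ?_
  rw [Pi.smul_apply, real_smul_vec, inner_smul_right, Complex.re_ofReal_mul]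

/-- The helicity pairing `∑_k Re⟪a_k, 2πi k × b_k⟫` is real-homogeneous in the second slot. [folklore] -/
theorem frustratedProfile_sum_re_inner_curlVec_smul {S : Finset (Fin 3 → ℤ)} (a b : ↥S → EuclideanSpace ℂ (Fin 3))
    (r : ℝ) :
    ∑ k : ↥S, (inner ℂ (a k) (curlVec (k : Fin 3 → ℤ) ((r • b) k))).re =
      r * ∑ k : ↥S, (inner ℂ (a k) (curlVec (k : Fin 3 → ℤ) (b k))).re := by
  rw [Finset.mul_sum]
  refine Finset.sum_congr rfl fun k _ => ?_
  rw [Pi.smul_apply, curlVec_real_smul, real_smul_vec, inner_smul_right, Complex.re_ofReal_mul]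

/-- **Energy balance against the force**: for `g, c` in the Galerkin space of a symmetric `S`,
`∑_k Re⟪ĝ_k, c_k⟫ = ∑_k Re⟪F₀(c)_k, c_k⟫` (the quadratic part does no work). [folklore] -/
theorem frustratedProfile_work_eq {S : Finset (Fin 3 → ℤ)} (hS : ∀ k ∈ S, -k ∈ S)
    {g c : ↥S → EuclideanSpace ℂ (Fin 3)} (hg : g ∈ galerkinSubspace S) (hc : c ∈ galerkinSubspace S) :
    ∑ k : ↥S, (inner ℂ (g k) (c k)).re = ∑ k : ↥S, (inner ℂ (galerkinRHS S 0 g c k) (c k)).re := by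
  rw [frustratedProfile_galerkinRHS_zero_eq hg]
  simp only [Pi.sub_apply, inner_sub_left, Complex.sub_re, Finset.sum_sub_distrib,
    sum_re_inner_projB_self hS hc, sub_zero]

/-- **Helicity balance against the force**: for `g, c` in the Galerkin space of a symmetric `S`,
`∑_k Re⟪ĝ_k, 2πi k × c_k⟫ = ∑_k Re⟪F₀(c)_k, 2πi k × c_k⟫` (the truncation conserves helicity). [folklore] -/
theorem frustratedProfile_helicity_eq {S : Finset (Fin 3 → ℤ)} (hS : ∀ k ∈ S, -k ∈ S)
    {g c : ↥S → EuclideanSpace ℂ (Fin 3)} (hg : g ∈ galerkinSubspace S) (hc : c ∈ galerkinSubspace S) :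
    ∑ k : ↥S, (inner ℂ (g k) (curlVec (k : Fin 3 → ℤ) (c k))).re =
      ∑ k : ↥S, (inner ℂ (galerkinRHS S 0 g c k) (curlVec (k : Fin 3 → ℤ) (c k))).re := by
  rw [frustratedProfile_galerkinRHS_zero_eq hg]
  simp only [Pi.sub_apply, inner_sub_left, Complex.sub_re, Finset.sum_sub_distrib,
    helicityIdentity_holds hS c hc, sub_zero]

/-- The curl symbol `w ↦ 2πi k × w` is continuous (a real-linear map in finite dimensions). [folklore] -/
theorem frustratedProfile_continuous_curlVec (k : Fin 3 → ℤ) : Continuous (curlVec k) :=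
  LinearMap.continuous_of_finiteDimensional
    ({ toFun := curlVec k, map_add' := curlVec_add k, map_smul' := curlVec_real_smul k } :
      EuclideanSpace ℂ (Fin 3) →ₗ[ℝ] EuclideanSpace ℂ (Fin 3))

/-- The work pairing `(a, b) ↦ ∑_k Re⟪a_k, b_k⟫` is jointly continuous. [folklore] -/
theorem frustratedProfile_continuous_work (S : Finset (Fin 3 → ℤ)) :
    Continuous fun p : (↥S → EuclideanSpace ℂ (Fin 3)) × (↥S → EuclideanSpace ℂ (Fin 3)) =>
      ∑ k : ↥S, (inner ℂ (p.1 k) (p.2 k)).re := by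
  refine continuous_finsetSum _ fun k _ => ?_
  exact Complex.continuous_re.comp
    (((continuous_apply k).comp continuous_fst).inner ((continuous_apply k).comp continuous_snd))

/-- The helicity pairing `(a, b) ↦ ∑_k Re⟪a_k, 2πi k × b_k⟫` is jointly continuous. [folklore] -/
theorem frustratedProfile_continuous_helicity (S : Finset (Fin 3 → ℤ)) :
    Continuous fun p : (↥S → EuclideanSpace ℂ (Fin 3)) × (↥S → EuclideanSpace ℂ (Fin 3)) =>
      ∑ k : ↥S, (inner ℂ (p.1 k) (curlVec (k : Fin 3 → ℤ) (p.2 k))).re := by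
  refine continuous_finsetSum _ fun k _ => ?_
  exact Complex.continuous_re.comp
    (((continuous_apply k).comp continuous_fst).inner
      ((frustratedProfile_continuous_curlVec (k : Fin 3 → ℤ)).comp ((continuous_apply k).comp continuous_snd)))

/-- **Frustrated profile.** If the truncated Euler map is not proper at `g`, there is a unit
truncated-Euler state `U` in the Galerkin space, work-free and helicity-free against `g`, which is an asymptotic
direction of the fibre over `g`. [folklore] -/
theorem stub_frustratedProfile (N : ℕ) (g : ↥(PB N) → EuclideanSpace ℂ (Fin 3))
    (hg : g ∈ galerkinSubspace (PB N))
    (hnot : ¬ ∃ M δ : ℝ, 0 < δ ∧ ∀ c ∈ galerkinSubspace (PB N), M ≤ ‖c‖ → δ ≤ ‖galerkinRHS (PB N) 0 g c‖) :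
    ∃ U ∈ galerkinSubspace (PB N), ‖U‖ = 1 ∧ galerkinRHS (PB N) 0 0 U = 0 ∧
      (∑ k : ↥(PB N), (inner ℂ (g k) (U k)).re) = 0 ∧
      (∑ k : ↥(PB N), (inner ℂ (g k) (curlVec (k : Fin 3 → ℤ) (U k))).re) = 0 ∧
      ∃ c : ℕ → (↥(PB N) → EuclideanSpace ℂ (Fin 3)),
        (∀ n, c n ∈ galerkinSubspace (PB N)) ∧
        Tendsto (fun n => ‖c n‖) atTop atTop ∧
        Tendsto (fun n => galerkinRHS (PB N) 0 g (c n)) atTop (𝓝 0) ∧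
        Tendsto (fun n => ‖c n‖⁻¹ • c n) atTop (𝓝 U) := by
  -- (0) a sequence witnessing non-properness: `‖c n‖ ≥ n + 1`, `‖F₀(c n)‖ < 1/(n+1)`
  have hex : ∀ n : ℕ, ∃ c ∈ galerkinSubspace (PB N),
      (n : ℝ) + 1 ≤ ‖c‖ ∧ ‖galerkinRHS (PB N) 0 g c‖ < 1 / ((n : ℝ) + 1) := by
    intro n
    by_contra h
    push Not at h
    exact hnot ⟨(n : ℝ) + 1, 1 / ((n : ℝ) + 1), by positivity, h⟩
  choose c hcG hcn hcF using hex
  have hpos : ∀ n, 0 < ‖c n‖ := fun n => lt_of_lt_of_le (by positivity) (hcn n)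
  have hnorm : Tendsto (fun n => ‖c n‖) atTop atTop :=
    tendsto_atTop_mono hcn (tendsto_atTop_add_const_right _ 1 tendsto_natCast_atTop_atTop)
  have hr : Tendsto (fun n => ‖c n‖⁻¹) atTop (𝓝 0) := tendsto_inv_atTop_zero.comp hnorm
  have hF : Tendsto (fun n => galerkinRHS (PB N) 0 g (c n)) atTop (𝓝 0) :=
    squeeze_zero_norm (fun n => (hcF n).le) tendsto_one_div_add_atTop_nhds_zero_nat
  -- (1) the unit vectors and a convergent subsequence
  set u : ℕ → (↥(PB N) → EuclideanSpace ℂ (Fin 3)) := fun n => ‖c n‖⁻¹ • c n with hu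
  have hu1 : ∀ n, ‖u n‖ = 1 := fun n => by
    simp only [hu]
    rw [norm_smul, norm_inv, norm_norm, inv_mul_cancel₀ (hpos n).ne']
  have huG : ∀ n, u n ∈ galerkinSubspace (PB N) := fun n => Submodule.smul_mem _ _ (hcG n)
  have husph : ∀ n, u n ∈ Metric.sphere (0 : ↥(PB N) → EuclideanSpace ℂ (Fin 3)) 1 := fun n =>
    mem_sphere_zero_iff_norm.2 (hu1 n)
  obtain ⟨U, hUsph, φ, hφ, hUlim⟩ := (isCompact_sphere (0 : ↥(PB N) → EuclideanSpace ℂ (Fin 3)) 1).tendsto_subseq husph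
  have hU1 : ‖U‖ = 1 := mem_sphere_zero_iff_norm.1 hUsph
  have hUG : U ∈ galerkinSubspace (PB N) :=
    (Submodule.closed_of_finiteDimensional (galerkinSubspace (PB N))).mem_of_tendsto hUlim
      (Eventually.of_forall fun n => huG (φ n))
  -- (2) `Q_S(U,U) = 0`
  have hE : ∀ n, galerkinRHS (PB N) 0 0 (u n) =
      (‖c n‖⁻¹ * ‖c n‖⁻¹) • (galerkinRHS (PB N) 0 g (c n) - g) := by
    intro n
    simp only [hu]
    rw [frustratedProfile_galerkinRHS_zero_zero_smul, frustratedProfile_galerkinRHS_zero_zero_eq,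
      frustratedProfile_galerkinRHS_zero_eq hg, sub_sub_cancel_left]
  have hElim : Tendsto (fun n => galerkinRHS (PB N) 0 0 (u n)) atTop (𝓝 0) := by
    have h := (hr.mul hr).smul (hF.sub_const g)
    rw [mul_zero, zero_smul] at h
    refine h.congr fun n => ?_
    exact (hE n).symm
  have hQU : galerkinRHS (PB N) 0 0 U = 0 := by
    have hQ1 := ((frustratedProfile_continuous_galerkinRHS_zero_zero (PB N)).tendsto U).comp hUlim
    have hQ2 := hElim.comp hφ.tendsto_atTop
    simp only [Function.comp_def] at hQ1 hQ2
    exact tendsto_nhds_unique hQ1 hQ2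
  -- (3) along the subsequence: `F₀(c_{φ n}) → 0`, `(F₀(c_{φ n}), u_{φ n}) → (0, U)`, `(g, u_{φ n}) → (g, U)`
  have hnorm' := hnorm.comp hφ.tendsto_atTop
  have hF' := hF.comp hφ.tendsto_atTop
  have hpair := hF'.prodMk_nhds hUlim
  have hpair' := (tendsto_const_nhds (x := g) (f := (atTop : Filter ℕ))).prodMk_nhds hUlim
  simp only [Function.comp_def] at hnorm' hF' hpair hpair'
  -- (4) work-free: `∑ Re⟪ĝ_k, (u_m)_k⟫ = ∑ Re⟪F₀(c_m)_k, (u_m)_k⟫ → ⟨0, U⟩ = 0`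
  have hWptw : ∀ m, (∑ k : ↥(PB N), (inner ℂ (g k) (u m k)).re) =
      ∑ k : ↥(PB N), (inner ℂ (galerkinRHS (PB N) 0 g (c m) k) (u m k)).re := by
    intro m
    simp only [hu]
    rw [frustratedProfile_sum_re_inner_smul, frustratedProfile_sum_re_inner_smul,
      frustratedProfile_work_eq (PB_symm N) hg (hcG m)]
  have hW : (∑ k : ↥(PB N), (inner ℂ (g k) (U k)).re) = 0 := by
    have h1 := ((frustratedProfile_continuous_work (PB N)).tendsto _).comp hpair
    have h2 := ((frustratedProfile_continuous_work (PB N)).tendsto _).comp hpair'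
    simp only [Function.comp_def, Pi.zero_apply, inner_zero_left, Complex.zero_re,
      Finset.sum_const_zero] at h1
    simp only [Function.comp_def] at h2
    exact tendsto_nhds_unique h2 (h1.congr fun n => (hWptw (φ n)).symm)
  -- (5) helicity-free: same with `2πi k ×` inserted, by helicity conservation of the truncation
  have hHptw : ∀ m, (∑ k : ↥(PB N), (inner ℂ (g k) (curlVec (k : Fin 3 → ℤ) (u m k))).re) =
      ∑ k : ↥(PB N), (inner ℂ (galerkinRHS (PB N) 0 g (c m) k) (curlVec (k : Fin 3 → ℤ) (u m k))).re := by
    intro m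
    simp only [hu]
    rw [frustratedProfile_sum_re_inner_curlVec_smul, frustratedProfile_sum_re_inner_curlVec_smul,
      frustratedProfile_helicity_eq (PB_symm N) hg (hcG m)]
  have hH : (∑ k : ↥(PB N), (inner ℂ (g k) (curlVec (k : Fin 3 → ℤ) (U k))).re) = 0 := by
    have h1 := ((frustratedProfile_continuous_helicity (PB N)).tendsto _).comp hpair
    have h2 := ((frustratedProfile_continuous_helicity (PB N)).tendsto _).comp hpair'
    simp only [Function.comp_def, Pi.zero_apply, inner_zero_left, Complex.zero_re,
      Finset.sum_const_zero] at h1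
    simp only [Function.comp_def] at h2
    exact tendsto_nhds_unique h2 (h1.congr fun n => (hHptw (φ n)).symm)
  -- (6) the asymptotic sequence `c ∘ φ`
  have hu' := hUlim
  simp only [hu, Function.comp_def] at hu'
  exact ⟨U, hUG, hU1, hQU, hW, hH, fun n => c (φ n), fun n => hcG (φ n), hnorm', hF', hu'⟩

end Summit.AnomalousDissipation.AnomalousDissipation.Theorems.GenericRunawayStokesScaling.Line

end
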